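import Literature.Geometry.Riemannian.RicciFlowSpatialRicciBounds
import Literature.Geometry.Riemannian.RicciFlowChartRmCovariantNorms
import HarnessLib

/-!
# Coordinate derivatives of the covariant Ricci derivatives and of the round defect: pointwise bounds
(helper file 9 for stub `stub_smoothRoundLimit`, line `margerin-cone-hamilton-rails`, crux
`EntropyRung.ChangGurskyYang`, item stmt-SmoothPoincare4-10834)

Pure coordinate calculus (`MetricCoord`) at a point `y` of the domain of metric components `Gs`,
with `R_k = ∇ᵏRic` the component arrays `tcovIter Gs b k (ric2 Gs b)`:

* `fderiv_tcovIter_eq` — `∂_q (R_k)_J = (R_{k+1})_{(qJ)'} + Σ_a Σ_m Γ^m_{q J_a} (R_k)_{J[a↦m]}` as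
  an identity of functions (O'Neill, Prop. 2.13 read backwards: `fderiv_tcovIter_apply`);
* `abs_tcovIter_succ_le_pd` — conversely every component of `R_{k+1}` is such a `∂_q (R_k)_J`
  up to `Γ ⋆ R_k`;
* `abs_pd_pd_tcovIter_le` — **the second coordinate derivatives `∂_p ∂_q (R_k)_J` at `y` are
  bounded by `c_{k+2} + (k+3) n L c_{k+1} + (k+2) n (L' c_k + L(c_{k+1} + (k+2) n L c_k))`** in
  terms of pointwise bounds `L, L'` of `Γ, ∂Γ` and `c_j` of `R_j` at `y`;
* `fderiv_defect_eq`, `abs_tcovIter_one_le_pd_defect`, `abs_pd_pd_defect_le` — the same for the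
  round defect `φ_J = (R_0)_J − (2h)⁻¹ G_{J}` (`h` a constant): `∂_q φ_J = (R_1)_{(qJ)'} +
  Σ Γ ⋆ φ` (because `∇g = 0`, `fderiv_metric_apply_basis`).

These feed Landau's interpolation (helper file 8) along the scaled Ricci flow, where `Γ, ∂Γ` grow
logarithmically (helper files 6–7), `R_j` are bounded (scaled Shi) and `φ` decays (roundness):
Hamilton 1982, §17.

## References

* B. O'Neill, *Semi-Riemannian geometry*, Academic Press 1983, Ch. 2, Prop. 2.13; Ch. 3,
  Prop. 3.13. [ONeill1983]
* R. S. Hamilton, *Three-manifolds with positive Ricci curvature*, J. Differential Geom. 17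
  (1982) 255–306, §12, §17. [Hamilton1982]
-/

noncomputable section

-- every `Summit.SmoothPoincare4.SmoothPoincare4.…` name repeats the summit = sub-problem segment (D-0017 layout)
set_option linter.dupNamespace false

-- operator spaces of bilinear forms over the model space
set_option maxSynthPendingDepth 3

open Set Function Filter Real Module Metric
open scoped Topology ContDiff

namespace Summit.SmoothPoincare4.SmoothPoincare4.Theorems.MargerinRails

open Literature.Geometry.Lorentzian Literature.Geometry.Lorentzian.MetricCoord

universe u

section Pointwise

variable {E : Type u} [NormedAddCommGroup E] [NormedSpace ℝ E] [FiniteDimensional ℝ E]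
  [CompleteSpace E] {ι : Type*} [Fintype ι] (b : Basis ι ℝ E)
  {Gs : E → E →L[ℝ] E →L[ℝ] ℝ} {V : Set E}

/-! ### Sums over the slot types -/

omit [FiniteDimensional ℝ E] [CompleteSpace E] in
/-- A double sum of terms bounded by `B` is bounded by `(#α · #ι) B`. [folklore] -/
theorem abs_sum_sum_le {α : Type*} [Fintype α] {f : α → ι → ℝ} {B : ℝ}
    (h : ∀ a m, |f a m| ≤ B) : |∑ a, ∑ m, f a m| ≤ Fintype.card α * Fintype.card ι * B := by
  calc |∑ a, ∑ m, f a m| ≤ ∑ a, |∑ m, f a m| := Finset.abs_sum_le_sum_abs _ _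
    _ ≤ ∑ a, ∑ m, |f a m| := Finset.sum_le_sum fun a _ ↦ Finset.abs_sum_le_sum_abs _ _
    _ ≤ ∑ _a : α, ∑ _m : ι, B := Finset.sum_le_sum fun a _ ↦ Finset.sum_le_sum fun m _ ↦ h a m
    _ = Fintype.card α * Fintype.card ι * B := by
        rw [Finset.sum_const, Finset.sum_const, Finset.card_univ, Finset.card_univ, nsmul_eq_mul,
          nsmul_eq_mul]; ring

/-! ### The covariant Ricci derivatives -/

omit [CompleteSpace E] in
/-- **`∂_q (∇ᵏRic)_J = (∇ᵏ⁺¹Ric)_{(qJ)'} + Σ_a Σ_m Γ^m_{q J_a} (∇ᵏRic)_{J[a↦m]}` as functions**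
(`fderiv_tcovIter_apply`). [cite: ONeill1983, Ch. 2, Prop. 2.13] -/
theorem fderiv_tcovIter_eq (k : ℕ) (q : ι) (J : Fin k ⊕ Fin 2 → ι) :
    pd b q (fun z ↦ tcovIter Gs b k (ric2 Gs b) z J) = fun z ↦
      tcovIter Gs b (k + 1) (ric2 Gs b) z (ocons q J ∘ ⇑(shiftEquiv k (Fin 2)).symm)
        + ∑ a, ∑ m, chrCoef Gs b z q (J a) m * tcovIter Gs b k (ric2 Gs b) z (update J a m) := by
  funext z
  exact fderiv_tcovIter_apply k (ric2 Gs b) z q J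

omit [CompleteSpace E] in
/-- **Every component of `∇ᵏ⁺¹Ric` is a coordinate derivative of a component of `∇ᵏRic` up to
`Γ ⋆ ∇ᵏRic`**: with `q = J' (inl 0)` and `J = J' ∘ shift ∘ some`,
`|(∇ᵏ⁺¹Ric)_{J'}| ≤ |∂_q (∇ᵏRic)_J| + (k+2) n L c_k`. [cite: ONeill1983, Ch. 2, Prop. 2.13] -/
theorem abs_tcovIter_succ_le_pd (k : ℕ) {y : E} {L c : ℝ} (hL : ∀ j i m, |chrCoef Gs b y j i m| ≤ L)
    (hc : ∀ J : Fin k ⊕ Fin 2 → ι, |tcovIter Gs b k (ric2 Gs b) y J| ≤ c)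
    (J' : Fin (k + 1) ⊕ Fin 2 → ι) :
    |tcovIter Gs b (k + 1) (ric2 Gs b) y J'| ≤
      |pd b (J' (shiftEquiv k (Fin 2) none)) (fun z ↦ tcovIter Gs b k (ric2 Gs b) z
          ((J' ∘ ⇑(shiftEquiv k (Fin 2))) ∘ some)) y| + Fintype.card (Fin k ⊕ Fin 2) * Fintype.card ι * (L * c) := by
  set q : ι := J' (shiftEquiv k (Fin 2) none) with hq
  set J : Fin k ⊕ Fin 2 → ι := (J' ∘ ⇑(shiftEquiv k (Fin 2))) ∘ some with hJ
  have hJ' : ocons q J ∘ ⇑(shiftEquiv k (Fin 2)).symm = J' := by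
    have h1 : ocons q J = J' ∘ ⇑(shiftEquiv k (Fin 2)) := ocons_eta (J' ∘ ⇑(shiftEquiv k (Fin 2)))
    rw [h1, Function.comp_assoc, Equiv.self_comp_symm, Function.comp_id]
  have hid : pd b q (fun z ↦ tcovIter Gs b k (ric2 Gs b) z J) y =
      tcovIter Gs b (k + 1) (ric2 Gs b) y (ocons q J ∘ ⇑(shiftEquiv k (Fin 2)).symm)
        + ∑ a, ∑ m, chrCoef Gs b y q (J a) m * tcovIter Gs b k (ric2 Gs b) y (update J a m) :=
    congrFun (fderiv_tcovIter_eq b (Gs := Gs) k q J) y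
  rw [hJ'] at hid
  have hL0 : 0 ≤ L := (abs_nonneg _).trans (hL q q q)
  have hsum : |∑ a, ∑ m, chrCoef Gs b y q (J a) m * tcovIter Gs b k (ric2 Gs b) y (update J a m)| ≤
      Fintype.card (Fin k ⊕ Fin 2) * Fintype.card ι * (L * c) :=
    abs_sum_sum_le fun a m ↦ by
      rw [abs_mul]; exact mul_le_mul (hL _ _ _) (hc _) (abs_nonneg _) hL0
  have heq : tcovIter Gs b (k + 1) (ric2 Gs b) y J' =
      pd b q (fun z ↦ tcovIter Gs b k (ric2 Gs b) z J) y -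
        ∑ a, ∑ m, chrCoef Gs b y q (J a) m * tcovIter Gs b k (ric2 Gs b) y (update J a m) := by
    rw [hid]; ring
  rw [heq]
  exact (abs_sub _ _).trans (add_le_add le_rfl hsum)

omit [CompleteSpace E] in
/-- **Bound of the first coordinate derivatives of `(∇ᵏRic)_J` at a point**:
`|∂_q (∇ᵏRic)_J| ≤ c_{k+1} + (k+2) n L c_k`. [cite: ONeill1983, Ch. 2, Prop. 2.13] -/
theorem abs_pd_tcovIter_le (k : ℕ) {y : E} {L c₀ c₁ : ℝ} (hL : ∀ j i m, |chrCoef Gs b y j i m| ≤ L)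
    (h0 : ∀ J : Fin k ⊕ Fin 2 → ι, |tcovIter Gs b k (ric2 Gs b) y J| ≤ c₀)
    (h1 : ∀ J : Fin (k + 1) ⊕ Fin 2 → ι, |tcovIter Gs b (k + 1) (ric2 Gs b) y J| ≤ c₁)
    (q : ι) (J : Fin k ⊕ Fin 2 → ι) :
    |pd b q (fun z ↦ tcovIter Gs b k (ric2 Gs b) z J) y| ≤
      c₁ + Fintype.card (Fin k ⊕ Fin 2) * Fintype.card ι * (L * c₀) := by
  have hid : pd b q (fun z ↦ tcovIter Gs b k (ric2 Gs b) z J) y =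
      tcovIter Gs b (k + 1) (ric2 Gs b) y (ocons q J ∘ ⇑(shiftEquiv k (Fin 2)).symm)
        + ∑ a, ∑ m, chrCoef Gs b y q (J a) m * tcovIter Gs b k (ric2 Gs b) y (update J a m) :=
    congrFun (fderiv_tcovIter_eq b (Gs := Gs) k q J) y
  rw [hid]
  have hL0 : 0 ≤ L := (abs_nonneg _).trans (hL q q q)
  refine (abs_add_le _ _).trans (add_le_add (h1 _) (abs_sum_sum_le fun a m ↦ ?_))
  rw [abs_mul]; exact mul_le_mul (hL _ _ _) (h0 _) (abs_nonneg _) hL0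

/-- **Bound of the second coordinate derivatives of `(∇ᵏRic)_J` at a point** of `V`: with
`|Γ| ≤ L`, `|∂Γ| ≤ L'`, `|R_k| ≤ c₀`, `|R_{k+1}| ≤ c₁`, `|R_{k+2}| ≤ c₂` at `y`,
`|∂_p ∂_q (R_k)_J (y)| ≤ (c₂ + (k+3) n L c₁) + (k+2) n (L' c₀ + L (c₁ + (k+2) n L c₀))`
(differentiate `fderiv_tcovIter_eq` once more: product rule and the same identity at the next
order). [cite: ONeill1983, Ch. 2, Prop. 2.13] [cite: Hamilton1982, §12] -/
theorem abs_pd_pd_tcovIter_le (hGs : IsMetricOn Gs V) (k : ℕ) {y : E} (hy : y ∈ V)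
    {L L' c₀ c₁ c₂ : ℝ} (hL : ∀ j i m, |chrCoef Gs b y j i m| ≤ L)
    (hL' : ∀ p j i m, |pd b p (fun z ↦ chrCoef Gs b z j i m) y| ≤ L')
    (h0 : ∀ J : Fin k ⊕ Fin 2 → ι, |tcovIter Gs b k (ric2 Gs b) y J| ≤ c₀)
    (h1 : ∀ J : Fin (k + 1) ⊕ Fin 2 → ι, |tcovIter Gs b (k + 1) (ric2 Gs b) y J| ≤ c₁)
    (h2 : ∀ J : Fin (k + 2) ⊕ Fin 2 → ι, |tcovIter Gs b (k + 2) (ric2 Gs b) y J| ≤ c₂)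
    (p q : ι) (J : Fin k ⊕ Fin 2 → ι) :
    |pd b p (pd b q (fun z ↦ tcovIter Gs b k (ric2 Gs b) z J)) y| ≤
      (c₂ + Fintype.card (Fin (k + 1) ⊕ Fin 2) * Fintype.card ι * (L * c₁)) +
        Fintype.card (Fin k ⊕ Fin 2) * Fintype.card ι *
          (L' * c₀ + L * (c₁ + Fintype.card (Fin k ⊕ Fin 2) * Fintype.card ι * (L * c₀))) := by
  have hV : IsOpen V := hGs.isOpen
  have hT : ∀ j, TSmoothOn (tcovIter Gs b j (ric2 Gs b)) V := fun j ↦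
    hGs.tsmoothOn_tcovIter (hGs.tsmoothOn_ric2 (b := b)) j
  have hL0 : 0 ≤ L := (abs_nonneg _).trans (hL q q q)
  -- the first derivative as a function, and its derivative at `y`
  rw [pd_apply, fderiv_tcovIter_eq b k q J]
  set R₁ : E → ℝ := fun z ↦ tcovIter Gs b (k + 1) (ric2 Gs b) z (ocons q J ∘ ⇑(shiftEquiv k (Fin 2)).symm)
    with hR₁
  set gf : (Fin k ⊕ Fin 2) → ι → E → ℝ := fun a m z ↦ chrCoef Gs b z q (J a) m with hgf
  set R₀ : (Fin k ⊕ Fin 2) → ι → E → ℝ := fun a m z ↦ tcovIter Gs b k (ric2 Gs b) z (update J a m)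
    with hR₀
  have hR₁d : DifferentiableAt ℝ R₁ y := (hT (k + 1)).differentiableAt hV hy _
  have hgd : ∀ a m, DifferentiableAt ℝ (gf a m) y := fun a m ↦ hGs.differentiableAt_chrCoef (b := b) hy _ _ _
  have hR₀d : ∀ a m, DifferentiableAt ℝ (R₀ a m) y := fun a m ↦ (hT k).differentiableAt hV hy _
  have hderiv : HasFDerivAt (fun z ↦ R₁ z + ∑ a, ∑ m, gf a m z * R₀ a m z)
      (fderiv ℝ R₁ y + ∑ a, ∑ m, (gf a m y • fderiv ℝ (R₀ a m) y + R₀ a m y • fderiv ℝ (gf a m) y)) y :=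
    hR₁d.hasFDerivAt.add (HasFDerivAt.fun_sum fun a _ ↦ HasFDerivAt.fun_sum fun m _ ↦
      (hgd a m).hasFDerivAt.fun_mul (hR₀d a m).hasFDerivAt)
  have hfun : (fun z ↦ tcovIter Gs b (k + 1) (ric2 Gs b) z (ocons q J ∘ ⇑(shiftEquiv k (Fin 2)).symm)
      + ∑ a, ∑ m, chrCoef Gs b z q (J a) m * tcovIter Gs b k (ric2 Gs b) z (update J a m)) =
      fun z ↦ R₁ z + ∑ a, ∑ m, gf a m z * R₀ a m z := rfl
  rw [hfun, hderiv.fderiv]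
  simp only [add_apply, FunLike.coe_sum, Finset.sum_apply, FunLike.coe_smul, Pi.smul_apply, smul_eq_mul]
  -- the pieces
  have e1 : |fderiv ℝ R₁ y (b p)| ≤ c₂ + Fintype.card (Fin (k + 1) ⊕ Fin 2) * Fintype.card ι * (L * c₁) := by
    have := abs_pd_tcovIter_le b (Gs := Gs) (k + 1) hL h1 h2 p (ocons q J ∘ ⇑(shiftEquiv k (Fin 2)).symm)
    rwa [pd_apply] at this
  have e2 : ∀ a m, |fderiv ℝ (R₀ a m) y (b p)| ≤ c₁ + Fintype.card (Fin k ⊕ Fin 2) * Fintype.card ι * (L * c₀) := by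
    intro a m
    have := abs_pd_tcovIter_le b (Gs := Gs) k hL h0 h1 p (update J a m)
    rwa [pd_apply] at this
  have e3 : ∀ a m, |fderiv ℝ (gf a m) y (b p)| ≤ L' := fun a m ↦ by
    have := hL' p q (J a) m; rwa [pd_apply] at this
  have e4 : ∀ a m, |gf a m y| ≤ L := fun a m ↦ hL _ _ _
  have e5 : ∀ a m, |R₀ a m y| ≤ c₀ := fun a m ↦ h0 _
  refine (abs_add_le _ _).trans (add_le_add e1 (abs_sum_sum_le fun a m ↦ ?_))
  refine (abs_add_le _ _).trans ?_
  rw [abs_mul, abs_mul]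
  have hc₀ : 0 ≤ c₀ := (abs_nonneg _).trans (h0 J)
  calc |gf a m y| * |fderiv ℝ (R₀ a m) y (b p)| + |R₀ a m y| * |fderiv ℝ (gf a m) y (b p)|
      ≤ L * (c₁ + Fintype.card (Fin k ⊕ Fin 2) * Fintype.card ι * (L * c₀)) + c₀ * L' :=
        add_le_add (mul_le_mul (e4 a m) (e2 a m) (abs_nonneg _) hL0)
          (mul_le_mul (e5 a m) (e3 a m) (abs_nonneg _) hc₀)
    _ = L' * c₀ + L * (c₁ + Fintype.card (Fin k ⊕ Fin 2) * Fintype.card ι * (L * c₀)) := by ring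

/-! ### The round defect `φ_J = (R_0)_J − (2h)⁻¹ G_J` -/

/-- **`∂_q φ_J = (R_1)_{(qJ)'} + Σ_a Σ_m Γ^m_{q J_a} φ_{J[a↦m]}` on `V`** for the round defect
`φ_J(z) = Ric(G)(z)_J − c G(z)_J` with a constant `c` (`∇g = 0`: the Christoffel terms of the
metric part recombine, `fderiv_metric_apply_basis`). [cite: ONeill1983, Ch. 3, Prop. 3.13] -/
theorem fderiv_defect_eq (hGs : IsMetricOn Gs V) (c : ℝ) (q : ι) (J : Fin 0 ⊕ Fin 2 → ι) {z : E}
    (hz : z ∈ V) :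
    pd b q (fun z ↦ tcovIter Gs b 0 (ric2 Gs b) z J - c * Gs z (b (J (Sum.inr 0))) (b (J (Sum.inr 1)))) z =
      tcovIter Gs b 1 (ric2 Gs b) z (ocons q J ∘ ⇑(shiftEquiv 0 (Fin 2)).symm)
        + ∑ a, ∑ m, chrCoef Gs b z q (J a) m *
          (tcovIter Gs b 0 (ric2 Gs b) z (update J a m) -
            c * Gs z (b ((update J a m) (Sum.inr 0))) (b ((update J a m) (Sum.inr 1)))) := by
  have hV : IsOpen V := hGs.isOpen
  have hRd : DifferentiableAt ℝ (fun z ↦ tcovIter Gs b 0 (ric2 Gs b) z J) z :=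
    (hGs.tsmoothOn_tcovIter (hGs.tsmoothOn_ric2 (b := b)) 0).differentiableAt hV hz _
  have hGd : DifferentiableAt ℝ (fun z ↦ Gs z (b (J (Sum.inr 0))) (b (J (Sum.inr 1)))) z :=
    differentiableAt_clm_apply_const (differentiableAt_clm_apply_const (hGs.differentiableAt hz) _) _
  rw [pd_apply, fderiv_fun_sub hRd (hGd.const_mul c), fderiv_const_mul hGd]
  simp only [sub_apply, FunLike.coe_smul, Pi.smul_apply, smul_eq_mul]
  rw [fderiv_tcovIter_apply 0 (ric2 Gs b) z q J,
    hGs.fderiv_metric_apply_basis (b := b) hz q (J (Sum.inr 0)) (J (Sum.inr 1))]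
  -- the slot sums over `Fin 0 ⊕ Fin 2`
  simp only [Fintype.sum_sum_type, Finset.univ_eq_empty, Finset.sum_empty, zero_add, Fin.sum_univ_two]
  have hu00 : ∀ m, update J (Sum.inr 0) m (Sum.inr 0) = m := fun m ↦ by simp
  have hu01 : ∀ m, update J (Sum.inr 0) m (Sum.inr 1) = J (Sum.inr 1) := fun m ↦ by
    rw [update_of_ne (by simp)]
  have hu10 : ∀ m, update J (Sum.inr 1) m (Sum.inr 0) = J (Sum.inr 0) := fun m ↦ by
    rw [update_of_ne (by simp)]
  have hu11 : ∀ m, update J (Sum.inr 1) m (Sum.inr 1) = m := fun m ↦ by simp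
  simp only [hu00, hu01, hu10, hu11, mul_sub, Finset.sum_sub_distrib, Finset.mul_sum, mul_add,
    Finset.sum_add_distrib]
  ring_nf

/-- **Every component of `R_1` is a coordinate derivative of a component of the defect up to
`Γ ⋆ φ`**: `|(R_1)_{J'}| ≤ |∂_q φ_J| + 2 n L Φ₀`. [cite: ONeill1983, Ch. 3, Prop. 3.13] -/
theorem abs_tcovIter_one_le_pd_defect (hGs : IsMetricOn Gs V) (c : ℝ) {y : E} (hy : y ∈ V) {L Φ₀ : ℝ}
    (hL : ∀ j i m, |chrCoef Gs b y j i m| ≤ L)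
    (hΦ : ∀ J : Fin 0 ⊕ Fin 2 → ι, |tcovIter Gs b 0 (ric2 Gs b) y J -
      c * Gs y (b (J (Sum.inr 0))) (b (J (Sum.inr 1)))| ≤ Φ₀)
    (J' : Fin 1 ⊕ Fin 2 → ι) :
    |tcovIter Gs b 1 (ric2 Gs b) y J'| ≤
      |pd b (J' (shiftEquiv 0 (Fin 2) none)) (fun z ↦ tcovIter Gs b 0 (ric2 Gs b) z
          ((J' ∘ ⇑(shiftEquiv 0 (Fin 2))) ∘ some) -
          c * Gs z (b (((J' ∘ ⇑(shiftEquiv 0 (Fin 2))) ∘ some) (Sum.inr 0)))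
            (b (((J' ∘ ⇑(shiftEquiv 0 (Fin 2))) ∘ some) (Sum.inr 1)))) y| +
        Fintype.card (Fin 0 ⊕ Fin 2) * Fintype.card ι * (L * Φ₀) := by
  set q : ι := J' (shiftEquiv 0 (Fin 2) none) with hq
  set J : Fin 0 ⊕ Fin 2 → ι := (J' ∘ ⇑(shiftEquiv 0 (Fin 2))) ∘ some with hJ
  have hJ' : ocons q J ∘ ⇑(shiftEquiv 0 (Fin 2)).symm = J' := by
    have h1 : ocons q J = J' ∘ ⇑(shiftEquiv 0 (Fin 2)) := ocons_eta (J' ∘ ⇑(shiftEquiv 0 (Fin 2)))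
    rw [h1, Function.comp_assoc, Equiv.self_comp_symm, Function.comp_id]
  have hid := fderiv_defect_eq b hGs c q J hy
  rw [hJ'] at hid
  have hsum : |∑ a, ∑ m, chrCoef Gs b y q (J a) m *
      (tcovIter Gs b 0 (ric2 Gs b) y (update J a m) -
        c * Gs y (b ((update J a m) (Sum.inr 0))) (b ((update J a m) (Sum.inr 1))))| ≤
      Fintype.card (Fin 0 ⊕ Fin 2) * Fintype.card ι * (L * Φ₀) :=
    abs_sum_sum_le fun a m ↦ by
      rw [abs_mul]; exact mul_le_mul (hL _ _ _) (hΦ _) (abs_nonneg _) ((abs_nonneg _).trans (hL q q q))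
  have heq : tcovIter Gs b 1 (ric2 Gs b) y J' =
      pd b q (fun z ↦ tcovIter Gs b 0 (ric2 Gs b) z J - c * Gs z (b (J (Sum.inr 0))) (b (J (Sum.inr 1)))) y -
        ∑ a, ∑ m, chrCoef Gs b y q (J a) m *
          (tcovIter Gs b 0 (ric2 Gs b) y (update J a m) -
            c * Gs y (b ((update J a m) (Sum.inr 0))) (b ((update J a m) (Sum.inr 1)))) := by
    rw [hid]; ring
  rw [heq]
  exact (abs_sub _ _).trans (add_le_add le_rfl hsum)

/-- **Bound of the first coordinate derivatives of the defect at a point**: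
`|∂_q φ_J| ≤ c₁ + 2 n L Φ₀`. [cite: ONeill1983, Ch. 3, Prop. 3.13] -/
theorem abs_pd_defect_le (hGs : IsMetricOn Gs V) (c : ℝ) {y : E} (hy : y ∈ V) {L Φ₀ c₁ : ℝ}
    (hL : ∀ j i m, |chrCoef Gs b y j i m| ≤ L)
    (hΦ : ∀ J : Fin 0 ⊕ Fin 2 → ι, |tcovIter Gs b 0 (ric2 Gs b) y J -
      c * Gs y (b (J (Sum.inr 0))) (b (J (Sum.inr 1)))| ≤ Φ₀)
    (h1 : ∀ J : Fin 1 ⊕ Fin 2 → ι, |tcovIter Gs b 1 (ric2 Gs b) y J| ≤ c₁)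
    (q : ι) (J : Fin 0 ⊕ Fin 2 → ι) :
    |pd b q (fun z ↦ tcovIter Gs b 0 (ric2 Gs b) z J - c * Gs z (b (J (Sum.inr 0))) (b (J (Sum.inr 1)))) y| ≤
      c₁ + Fintype.card (Fin 0 ⊕ Fin 2) * Fintype.card ι * (L * Φ₀) := by
  rw [fderiv_defect_eq b hGs c q J hy]
  refine (abs_add_le _ _).trans (add_le_add (h1 _) (abs_sum_sum_le fun a m ↦ ?_))
  rw [abs_mul]; exact mul_le_mul (hL _ _ _) (hΦ _) (abs_nonneg _) ((abs_nonneg _).trans (hL q q q))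

/-- **Bound of the second coordinate derivatives of the defect at a point** of `V`: with
`|Γ| ≤ L`, `|∂Γ| ≤ L'`, `|φ| ≤ Φ₀`, `|R_1| ≤ c₁`, `|R_2| ≤ c₂` at `y`,
`|∂_p ∂_q φ_J (y)| ≤ (c₂ + 3 n L c₁) + 2 n (L' Φ₀ + L (c₁ + 2 n L Φ₀))`.
[cite: ONeill1983, Ch. 3, Prop. 3.13] [cite: Hamilton1982, §12] -/
theorem abs_pd_pd_defect_le (hGs : IsMetricOn Gs V) (c : ℝ) {y : E} (hy : y ∈ V)
    {L L' Φ₀ c₁ c₂ : ℝ} (hL : ∀ j i m, |chrCoef Gs b y j i m| ≤ L)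
    (hL' : ∀ p j i m, |pd b p (fun z ↦ chrCoef Gs b z j i m) y| ≤ L')
    (hΦ : ∀ J : Fin 0 ⊕ Fin 2 → ι, |tcovIter Gs b 0 (ric2 Gs b) y J -
      c * Gs y (b (J (Sum.inr 0))) (b (J (Sum.inr 1)))| ≤ Φ₀)
    (h1 : ∀ J : Fin 1 ⊕ Fin 2 → ι, |tcovIter Gs b 1 (ric2 Gs b) y J| ≤ c₁)
    (h2 : ∀ J : Fin 2 ⊕ Fin 2 → ι, |tcovIter Gs b 2 (ric2 Gs b) y J| ≤ c₂)
    (p q : ι) (J : Fin 0 ⊕ Fin 2 → ι) :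
    |pd b p (pd b q (fun z ↦ tcovIter Gs b 0 (ric2 Gs b) z J - c * Gs z (b (J (Sum.inr 0))) (b (J (Sum.inr 1))))) y| ≤
      (c₂ + Fintype.card (Fin 1 ⊕ Fin 2) * Fintype.card ι * (L * c₁)) +
        Fintype.card (Fin 0 ⊕ Fin 2) * Fintype.card ι *
          (L' * Φ₀ + L * (c₁ + Fintype.card (Fin 0 ⊕ Fin 2) * Fintype.card ι * (L * Φ₀))) := by
  have hV : IsOpen V := hGs.isOpen
  have hT : ∀ j, TSmoothOn (tcovIter Gs b j (ric2 Gs b)) V := fun j ↦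
    hGs.tsmoothOn_tcovIter (hGs.tsmoothOn_ric2 (b := b)) j
  have hL0 : 0 ≤ L := (abs_nonneg _).trans (hL q q q)
  -- the first derivative agrees near `y` with the explicit field
  set R₁ : E → ℝ := fun z ↦ tcovIter Gs b 1 (ric2 Gs b) z (ocons q J ∘ ⇑(shiftEquiv 0 (Fin 2)).symm) with hR₁
  set gf : (Fin 0 ⊕ Fin 2) → ι → E → ℝ := fun a m z ↦ chrCoef Gs b z q (J a) m with hgf
  set Φ : (Fin 0 ⊕ Fin 2) → ι → E → ℝ := fun a m z ↦ tcovIter Gs b 0 (ric2 Gs b) z (update J a m) -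
    c * Gs z (b ((update J a m) (Sum.inr 0))) (b ((update J a m) (Sum.inr 1))) with hΦdef
  have hev : pd b q (fun z ↦ tcovIter Gs b 0 (ric2 Gs b) z J - c * Gs z (b (J (Sum.inr 0))) (b (J (Sum.inr 1))))
      =ᶠ[𝓝 y] fun z ↦ R₁ z + ∑ a, ∑ m, gf a m z * Φ a m z :=
    Filter.eventually_of_mem (hV.mem_nhds hy) fun z hz ↦ fderiv_defect_eq b hGs c q J hz
  rw [pd_apply, hev.fderiv_eq]
  have hR₁d : DifferentiableAt ℝ R₁ y := (hT 1).differentiableAt hV hy _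
  have hgd : ∀ a m, DifferentiableAt ℝ (gf a m) y := fun a m ↦ hGs.differentiableAt_chrCoef (b := b) hy _ _ _
  have hΦd : ∀ a m, DifferentiableAt ℝ (Φ a m) y := fun a m ↦
    ((hT 0).differentiableAt hV hy _).sub
      ((differentiableAt_clm_apply_const (differentiableAt_clm_apply_const (hGs.differentiableAt hy) _) _).const_mul c)
  have hderiv : HasFDerivAt (fun z ↦ R₁ z + ∑ a, ∑ m, gf a m z * Φ a m z)
      (fderiv ℝ R₁ y + ∑ a, ∑ m, (gf a m y • fderiv ℝ (Φ a m) y + Φ a m y • fderiv ℝ (gf a m) y)) y :=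
    hR₁d.hasFDerivAt.add (HasFDerivAt.fun_sum fun a _ ↦ HasFDerivAt.fun_sum fun m _ ↦
      (hgd a m).hasFDerivAt.fun_mul (hΦd a m).hasFDerivAt)
  rw [hderiv.fderiv]
  simp only [add_apply, FunLike.coe_sum, Finset.sum_apply, FunLike.coe_smul, Pi.smul_apply, smul_eq_mul]
  -- the pieces
  have e1 : |fderiv ℝ R₁ y (b p)| ≤ c₂ + Fintype.card (Fin 1 ⊕ Fin 2) * Fintype.card ι * (L * c₁) := by
    have := abs_pd_tcovIter_le b (Gs := Gs) 1 hL h1 h2 p (ocons q J ∘ ⇑(shiftEquiv 0 (Fin 2)).symm)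
    rwa [pd_apply] at this
  have e2 : ∀ a m, |fderiv ℝ (Φ a m) y (b p)| ≤ c₁ + Fintype.card (Fin 0 ⊕ Fin 2) * Fintype.card ι * (L * Φ₀) := by
    intro a m
    have := abs_pd_defect_le b hGs c hy hL hΦ h1 p (update J a m)
    rwa [pd_apply] at this
  have e3 : ∀ a m, |fderiv ℝ (gf a m) y (b p)| ≤ L' := fun a m ↦ by
    have := hL' p q (J a) m; rwa [pd_apply] at this
  have e4 : ∀ a m, |gf a m y| ≤ L := fun a m ↦ hL _ _ _
  have e5 : ∀ a m, |Φ a m y| ≤ Φ₀ := fun a m ↦ hΦ _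
  have hΦ₀ : 0 ≤ Φ₀ := (abs_nonneg _).trans (hΦ J)
  refine (abs_add_le _ _).trans (add_le_add e1 (abs_sum_sum_le fun a m ↦ ?_))
  refine (abs_add_le _ _).trans ?_
  rw [abs_mul, abs_mul]
  calc |gf a m y| * |fderiv ℝ (Φ a m) y (b p)| + |Φ a m y| * |fderiv ℝ (gf a m) y (b p)|
      ≤ L * (c₁ + Fintype.card (Fin 0 ⊕ Fin 2) * Fintype.card ι * (L * Φ₀)) + Φ₀ * L' :=
        add_le_add (mul_le_mul (e4 a m) (e2 a m) (abs_nonneg _) hL0)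
          (mul_le_mul (e5 a m) (e3 a m) (abs_nonneg _) hΦ₀)
    _ = L' * Φ₀ + L * (c₁ + Fintype.card (Fin 0 ⊕ Fin 2) * Fintype.card ι * (L * Φ₀)) := by ring

/-- **HELPER `helper_abs_pd_pd_tcovIter_le`** — the registered form of `abs_pd_pd_tcovIter_le`
(pointwise bound of the second coordinate derivatives of the components of `∇ᵏRic` through
`Γ, ∂Γ, ∇ᵏRic, ∇ᵏ⁺¹Ric, ∇ᵏ⁺²Ric` at the point). [cite: ONeill1983, Ch. 2, Prop. 2.13] [cite: Hamilton1982, §12] -/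
theorem helper_abs_pd_pd_tcovIter_le : ∀ {E : Type u} [NormedAddCommGroup E] [NormedSpace ℝ E] [FiniteDimensional ℝ E] [CompleteSpace E] {ι : Type*} [Fintype ι] (b : Module.Basis ι ℝ E) {Gs : E → E →L[ℝ] E →L[ℝ] ℝ} {V : Set E}, MetricCoord.IsMetricOn Gs V → ∀ (k : ℕ) {y : E}, y ∈ V → ∀ {L L' c₀ c₁ c₂ : ℝ}, (∀ j i m, |MetricCoord.chrCoef Gs b y j i m| ≤ L) → (∀ p j i m, |MetricCoord.pd b p (fun z ↦ MetricCoord.chrCoef Gs b z j i m) y| ≤ L') → (∀ J : Fin k ⊕ Fin 2 → ι, |MetricCoord.tcovIter Gs b k (MetricCoord.ric2 Gs b) y J| ≤ c₀) → (∀ J : Fin (k + 1) ⊕ Fin 2 → ι, |MetricCoord.tcovIter Gs b (k + 1) (MetricCoord.ric2 Gs b) y J| ≤ c₁) → (∀ J : Fin (k + 2) ⊕ Fin 2 → ι, |MetricCoord.tcovIter Gs b (k + 2) (MetricCoord.ric2 Gs b) y J| ≤ c₂) → ∀ (p q : ι) (J : Fin k ⊕ Fin 2 → ι), |MetricCoord.pd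 b p (MetricCoord.pd b q (fun z ↦ MetricCoord.tcovIter Gs b k (MetricCoord.ric2 Gs b) z J)) y| ≤ (c₂ + Fintype.card (Fin (k + 1) ⊕ Fin 2) * Fintype.card ι * (L * c₁)) + Fintype.card (Fin k ⊕ Fin 2) * Fintype.card ι * (L' * c₀ + L * (c₁ + Fintype.card (Fin k ⊕ Fin 2) * Fintype.card ι * (L * c₀))) := by
  intro E _ _ _ _ ι _ b Gs V hGs k y hy L L' c₀ c₁ c₂ hL hL' h0 h1 h2 p q J
  exact abs_pd_pd_tcovIter_le b hGs k hy hL hL' h0 h1 h2 p q J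

end Pointwise

end Summit.SmoothPoincare4.SmoothPoincare4.Theorems.MargerinRails

end
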